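import Literature.GroupTheory.Coxeter.GramMatrixSpectrumFiniteTypes
import Literature.GroupTheory.Coxeter.FiniteTypeA
import HarnessLib

/-!
# The complete spectra of the Gram matrices of `A_n` and `B_n`: `{1 + cos(πm/(n+1)) : 1 ≤ m ≤ n}` and `{1 + cos(πk/2n) : k odd, k < 2n}`

Layer `Literature/GroupTheory/Coxeter`, namespace `Literature.GroupTheory.Coxeter`; lane `lit-hodgefound` (Track 2 foundations library; prover seat p18,
generation 55, fourteenth file — over `GramMatrixSpectrumFiniteTypes` (`isRoot_charpoly_gram_one_add_cos_iff_aeval_cexp`, `isRoot_charpoly_gram_typeB`),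
`GramMatrixSpectrumBipartite` (`exists_eq_one_add_cos_of_isRoot_charpoly_gram`: finite `W` ⟹ every eigenvalue of `A` is `1 + cos θ`, `θ = πm/h ∈ [0, π]`;
`isRoot_charpoly_gram_typeA`), `CoxeterElementCharpolyConjugacy` (`charpoly_wordProd_typeA/B`), `FiniteTypeA` ∕ `FiniteTypeB` and Mathlib's `Complex.exp_eq_one_iff`,
`Complex.exp_eq_exp_iff_exists_int`).

The previous files give one eigenvalue `1 + cos(πm/h)` of the Gram matrix per exponent `m`; here the converse inclusion is added for the two series whose characteristic
polynomial pins the angle down elementarily, so that the spectrum is determined EXACTLY (as a set): an eigenvalue is `1 + cos θ` with `χ_c(e^{2iθ}) = 0`; for `A_n`,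
`χ_c = 1 + X + ⋯ + X^n` forces `e^{2iθ(n+1)} = 1 ≠ e^{2iθ}`, i.e. `θ = πm/(n+1)` with `1 ≤ m ≤ n`; for `B_n`, `χ_c = X^n + 1` forces `e^{2iθn} = −1`, i.e. `θ = πk/2n`
with `k` odd — Humphreys' exponents `1, 2, …, n` and `1, 3, …, 2n − 1` (§3.7 Table 1) read as spectra:

* ★★★ `A_n`: **`γ` is an eigenvalue of the Gram matrix of `A_n` iff `γ = 1 + cos(πm/(n+1))` for some `1 ≤ m ≤ n`** (`isRoot_charpoly_gram_typeA_iff`) — the familiar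
  spectrum `2 − 2cos(πm/(n+1))` of the `A_n` Cartan matrix (path graph);
* ★★★ `B_n`: **`γ` is an eigenvalue of the Gram matrix of `B_n` iff `γ = 1 + cos(πk/2n)` for some odd `k < 2n`** (`isRoot_charpoly_gram_typeB_iff`).

PROVED theorems only (no definition, no named fact, no `sorry`: net debt 0); no instance, no notation.  Multiplicities are not discussed (all these eigenvalues are in
fact simple: `n` distinct values).

## Source, verbatim

J. E. Humphreys, *Reflection Groups and Coxeter Groups* (1990) [Humphreys1990], §3.7 Table 1 p. 59 («`A_n`: `1, 2, …, n`», «`B_n`: `1, 3, 5, …, 2n − 1`»), §3.16 p. 75,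
§3.19 Theorem p. 80.  R. Stekolshchik [Stekolshchik2008], Ch. 3 Proposition 3.1 (1) («`(λ+1)²/(4λ) = (γ−1)²`»).
-/

namespace Literature.GroupTheory.Coxeter

open Polynomial Complex
open scoped Matrix Real

/-! ### §1 Angles pinned down by `e^{2iθN} = ±1` -/

section Angles

/-- `e^{2iθN} = 1`, `N > 0`, `0 ≤ θ ≤ π` ⟹ `θ = πk/N` with `k ∈ ℕ`, `k ≤ N`. [folklore] -/
private theorem exists_eq_pi_mul_div_of_pow_eq_one {θ : ℝ} {N : ℕ} (hN : 0 < N) (h0 : 0 ≤ θ) (h1 : θ ≤ π) (he : cexp (2 * θ * I) ^ N = 1) :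
    ∃ k : ℕ, k ≤ N ∧ θ = π * k / N := by
  rw [← Complex.exp_nat_mul, Complex.exp_eq_one_iff] at he
  obtain ⟨n, hn⟩ := he
  have hre : (N : ℝ) * (2 * θ) = n * (2 * π) := by
    have h' := congrArg Complex.im hn
    simp only [Complex.mul_im, Complex.mul_re, Complex.natCast_re, Complex.natCast_im, Complex.ofReal_re, Complex.ofReal_im, Complex.I_re, Complex.I_im,
      Complex.re_ofNat, Complex.im_ofNat, Complex.intCast_re, Complex.intCast_im] at h'
    linarith
  have hNpos : (0 : ℝ) < N := Nat.cast_pos.mpr hN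
  have hθ : θ = π * n / N := by rw [eq_div_iff hNpos.ne']; linarith
  have hn0 : (0 : ℝ) ≤ n := by
    by_contra hc
    push Not at hc
    have : (N : ℝ) * (2 * θ) < 0 := by rw [hre]; nlinarith [Real.pi_pos]
    nlinarith
  have hnN : (n : ℝ) ≤ N := by
    have : (N : ℝ) * (2 * θ) ≤ N * (2 * π) := by nlinarith [Real.pi_pos]
    rw [hre] at this
    nlinarith [Real.pi_pos]
  have hn0' : (0 : ℤ) ≤ n := by exact_mod_cast hn0
  have hcast : ((n.toNat : ℕ) : ℝ) = (n : ℝ) := by rw [← Int.cast_natCast, Int.toNat_of_nonneg hn0']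
  refine ⟨n.toNat, ?_, ?_⟩
  · have : ((n.toNat : ℕ) : ℝ) ≤ N := by rw [hcast]; exact hnN
    exact_mod_cast this
  · rw [hθ, hcast]

/-- `e^{2iθN} = −1`, `N > 0`, `0 ≤ θ ≤ π` ⟹ `θ = πk/2N` with `k` odd, `k < 2N`. [folklore] -/
private theorem exists_eq_pi_mul_div_of_pow_eq_neg_one {θ : ℝ} {N : ℕ} (hN : 0 < N) (h0 : 0 ≤ θ) (h1 : θ ≤ π) (he : cexp (2 * θ * I) ^ N = -1) :
    ∃ k : ℕ, Odd k ∧ k < 2 * N ∧ θ = π * k / (2 * N) := by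
  rw [← Complex.exp_nat_mul, ← Complex.exp_pi_mul_I, Complex.exp_eq_exp_iff_exists_int] at he
  obtain ⟨n, hn⟩ := he
  have hre : (N : ℝ) * (2 * θ) = π + n * (2 * π) := by
    have h' := congrArg Complex.im hn
    simp only [Complex.mul_im, Complex.mul_re, Complex.add_im, Complex.natCast_re, Complex.natCast_im, Complex.ofReal_re, Complex.ofReal_im, Complex.I_re,
      Complex.I_im, Complex.re_ofNat, Complex.im_ofNat, Complex.intCast_re, Complex.intCast_im] at h'
    linarith
  have hNpos : (0 : ℝ) < N := Nat.cast_pos.mpr hN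
  have hθ : θ = π * (2 * n + 1) / (2 * N) := by rw [eq_div_iff (by positivity)]; linarith
  have hn0 : (0 : ℝ) ≤ 2 * n + 1 := by
    by_contra hc
    push Not at hc
    have : (N : ℝ) * (2 * θ) < 0 := by rw [hre]; nlinarith [Real.pi_pos]
    nlinarith
  have hnN : 2 * (n : ℝ) + 1 ≤ 2 * N := by
    have : (N : ℝ) * (2 * θ) ≤ N * (2 * π) := by nlinarith [Real.pi_pos]
    rw [hre] at this
    nlinarith [Real.pi_pos]
  have hn0' : (0 : ℤ) ≤ 2 * n + 1 := by exact_mod_cast hn0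
  have hn0'' : (0 : ℤ) ≤ n := by omega
  have hnN' : 2 * n + 1 ≤ 2 * (N : ℤ) := by exact_mod_cast hnN
  have hlt : 2 * n + 1 < 2 * (N : ℤ) := by omega
  have hcast : ((n.toNat : ℕ) : ℝ) = (n : ℝ) := by rw [← Int.cast_natCast, Int.toNat_of_nonneg hn0'']
  refine ⟨2 * n.toNat + 1, ⟨n.toNat, rfl⟩, ?_, ?_⟩
  · have : ((2 * n.toNat + 1 : ℕ) : ℤ) < 2 * N := by push_cast; rw [Int.toNat_of_nonneg hn0'']; exact hlt
    exact_mod_cast this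
  · rw [hθ]; push_cast; rw [hcast]

end Angles

/-! ### §2 The spectra of the Gram matrices of `A_n` and `B_n` -/

section Spectra

/-- ★★★ **Type `A_n`: `γ` is an eigenvalue of the Gram matrix iff `γ = 1 + cos(πm/(n+1))` for some `1 ≤ m ≤ n`** (exponents `1, …, n`, `h = n + 1`).
[cite: Humphreys1990, §3.7 Table 1 p. 59, §3.19 Theorem p. 80] [cite: Stekolshchik2008, Ch. 3 Proposition 3.1 (1)] -/
theorem isRoot_charpoly_gram_typeA_iff {n : ℕ} (γ : ℝ) :
    (gram (CoxeterMatrix.A n)).charpoly.IsRoot γ ↔ ∃ m : ℕ, 1 ≤ m ∧ m ≤ n ∧ γ = 1 + Real.cos (π * m / (n + 1)) := by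
  refine ⟨fun hγ ↦ ?_, fun ⟨m, hm1, hmn, hγ⟩ ↦ hγ ▸ isRoot_charpoly_gram_typeA hm1 hmn⟩
  set cs := (CoxeterMatrix.A n).toCoxeterSystem
  haveI := finite_of_type_A cs
  obtain ⟨m, hm, hγm⟩ := exists_eq_one_add_cos_of_isRoot_charpoly_gram cs (fun i ↦ decide ((i : ℕ) % 2 = 0)) (fun i j hij h ↦ twoColouring_typeA i j hij h)
    (List.nodup_finRange n) List.mem_finRange hγ
  set h := orderOf (cs.wordProd (List.finRange n)) with hh
  have hhpos : 0 < h := (isOfFinOrder_of_finite _).orderOf_pos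
  set θ := π * m / h with hθ
  have hθ0 : 0 ≤ θ := by positivity
  have hθ1 : θ ≤ π := by
    rw [hθ, div_le_iff₀ (Nat.cast_pos.mpr hhpos)]
    have : (m : ℝ) ≤ h := by exact_mod_cast hm
    nlinarith [Real.pi_pos]
  -- `e^{2iθ}` is a root of `1 + X + ⋯ + X^n`
  have hroot := (isRoot_charpoly_gram_one_add_cos_iff_aeval_cexp cs (List.nodup_finRange n) List.mem_finRange θ).1 (by rw [← hγm]; exact hγ)
  rw [charpoly_wordProd_typeA cs (List.nodup_finRange n) List.mem_finRange, map_sum] at hroot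
  simp only [map_pow, aeval_X] at hroot
  set t := cexp (2 * θ * I) with ht
  have hpow : t ^ (n + 1) = 1 := by
    have := geom_sum_mul t (n + 1)
    rw [hroot, zero_mul] at this
    exact (sub_eq_zero.mp this.symm)
  have hne : t ≠ 1 := by
    intro h1
    rw [h1] at hroot
    simp only [one_pow, Finset.sum_const, Finset.card_range, nsmul_eq_mul, mul_one] at hroot
    exact Nat.cast_ne_zero.mpr (Nat.succ_ne_zero n) hroot
  obtain ⟨k, hk, hθk⟩ := exists_eq_pi_mul_div_of_pow_eq_one (Nat.succ_pos n) hθ0 hθ1 hpow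
  refine ⟨k, ?_, ?_, ?_⟩
  · -- `k = 0` would give `t = 1`
    rcases Nat.eq_zero_or_pos k with rfl | hk0
    · exfalso
      apply hne
      rw [ht, hθk]
      simp
    · exact hk0
  · -- `k = n + 1` would give `t = e^{2πi} = 1`
    rcases Nat.lt_or_ge k (n + 1) with hlt | hge
    · omega
    · exfalso
      apply hne
      have hk' : k = n + 1 := le_antisymm hk hge
      have hθπ : θ = π := by
        rw [hθk, hk', mul_div_assoc, div_self (Nat.cast_ne_zero.mpr (Nat.succ_ne_zero n)), mul_one]
      rw [ht, hθπ, Complex.exp_two_pi_mul_I]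
  · rw [hγm, hθk]
    push_cast
    ring_nf

/-- ★★★ **Type `B_n` (`n = m + 1`): `γ` is an eigenvalue of the Gram matrix iff `γ = 1 + cos(πk/2n)` for some odd `k < 2n`** (exponents `1, 3, …, 2n − 1`, `h = 2n`).
[cite: Humphreys1990, §3.7 Table 1 p. 59, §3.19 Theorem p. 80] [cite: Stekolshchik2008, Ch. 3 Proposition 3.1 (1)] -/
theorem isRoot_charpoly_gram_typeB_iff {m : ℕ} (γ : ℝ) :
    (gram (CoxeterMatrix.B (m + 1))).charpoly.IsRoot γ ↔ ∃ k : ℕ, Odd k ∧ k < 2 * (m + 1) ∧ γ = 1 + Real.cos (π * k / (2 * (m + 1))) := by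
  refine ⟨fun hγ ↦ ?_, fun ⟨k, hk, _, hγ⟩ ↦ hγ ▸ isRoot_charpoly_gram_typeB hk⟩
  set cs := (CoxeterMatrix.B (m + 1)).toCoxeterSystem
  haveI := finite_of_type_B cs
  obtain ⟨m', hm', hγm⟩ := exists_eq_one_add_cos_of_isRoot_charpoly_gram cs (fun i ↦ decide ((i : ℕ) % 2 = 0)) (fun i j hij h ↦ twoColouring_typeB i j hij h)
    (List.nodup_finRange (m + 1)) List.mem_finRange hγ
  set h := orderOf (cs.wordProd (List.finRange (m + 1))) with hh
  have hhpos : 0 < h := (isOfFinOrder_of_finite _).orderOf_pos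
  set θ := π * m' / h with hθ
  have hθ0 : 0 ≤ θ := by positivity
  have hθ1 : θ ≤ π := by
    rw [hθ, div_le_iff₀ (Nat.cast_pos.mpr hhpos)]
    have : (m' : ℝ) ≤ h := by exact_mod_cast hm'
    nlinarith [Real.pi_pos]
  have hroot := (isRoot_charpoly_gram_one_add_cos_iff_aeval_cexp cs (List.nodup_finRange (m + 1)) List.mem_finRange θ).1 (by rw [← hγm]; exact hγ)
  rw [charpoly_wordProd_typeB cs (List.nodup_finRange (m + 1)) List.mem_finRange, map_add, map_pow, aeval_X, map_one] at hroot
  have hpow : cexp (2 * θ * I) ^ (m + 1) = -1 := eq_neg_of_add_eq_zero_left hroot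
  obtain ⟨k, hk, hk2, hθk⟩ := exists_eq_pi_mul_div_of_pow_eq_neg_one (Nat.succ_pos m) hθ0 hθ1 hpow
  refine ⟨k, hk, hk2, ?_⟩
  rw [hγm, hθk]
  push_cast
  ring_nf

end Spectra

end Literature.GroupTheory.Coxeter
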